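import Summits.CriticalPhenomena.PercolationContinuityZ3.Theorems.PercNearOneGluingNoHeavyQuantShapePieceBlob
import Summits.CriticalPhenomena.PercolationContinuityZ3.Theorems.PercNearOneGluingNoHeavyQuantPieceBlobLongCertPB2GDA
import Summits.CriticalPhenomena.PercolationContinuityZ3.Theorems.PercNearOneGluingNoHeavyQuantPieceBlobLongCertPB2GDB
import Summits.CriticalPhenomena.PercolationContinuityZ3.Theorems.PercNearOneGluingNoHeavyQuantPieceBlobLongCertPB2GDC
import Summits.CriticalPhenomena.PercolationContinuityZ3.Theorems.PercNearOneGluingNoHeavyQuantPieceBlobLongCertPB2XDA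
import Summits.CriticalPhenomena.PercolationContinuityZ3.Theorems.PercNearOneGluingNoHeavyQuantPieceBlobLongCertPB2XDB
import Summits.CriticalPhenomena.PercolationContinuityZ3.Theorems.PercNearOneGluingNoHeavyQuantPieceBlobLongCertPB2XDC
import HarnessLib

/-!
# QUANT lane R8, T-DEC: THE PIECE BESIDE A BIG BLOB FOR EVERY SHAPE `lo < K ≤ 4lo` AND EVERY GATE — route algebra and the overflow's floor capacity at every floor (census-1 gen 33)

builds on p205010 (kernel theorem, internal audit signed; external expert review pending)

Support file (`--supports stmt-CriticalPhenomena-4575`), QUANT lane seat prim-quant-census-1 (gen 33); memo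
`run/shared/lean/prim/quant/prim-quant-census-1/g33/WIDE3-G33.md` §4.  Theorems only, standard axioms, no sorries.  This file: `pb_rate_sat`, `pb_split_sum`, `pb_rate_top`, `pb_glue_cap`, the case splits `pb_PB2GD`, `pb_PB2XD`, and the y-form brick `pb_PB2` (monotone in the floor).
THE RULE (memo §4; exact regression `g33/code/exp6_pieceblob_rule.py`, 0 failures on 13 shapes `lo < K ≤ 4lo`): per outer gate, the low atom `lo` of
`S(γ) ∗ blob_{lo+K}(g)` goes to `2lo+K` while `θ₁(ν(lo)+ν(2lo+K)) ≤ ν(2lo+K)` (`θ₁ = max(y, D/(lo+K))`, `D = T − 2lo`); otherwise the flow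
SPLITS — `a(1−γ)g(lo+K−D)/D` saturates `2lo+K`, the overflow `a(1−γ)(D−(lo+K)g)/D` goes to the top; for `D ≥ lo+K` everything goes to the top.
Bricks (polynomial inequalities in `lo, K, γ, g, D` (and `y`/`x`), K-units `c = lo/K ∈ [1/4, 1]` split into the boxes `[1/4,1/3]`, `[1/3,1/2]`, `[1/2,1]`):
PB1/PB2 (top capacity of the overflow: ρ / floor), PC1a–c / PC2a–c (split cost: ρ / floor regime, three budget sub-cases), PD1/PD2 (top capacity,
regime II), PE1/PE2 (top cost, regime II); the floor-regime bricks are certified at the floor bound `ȳ = (2lo+D)·x_max/T₀` (`…GD` / `…XD` for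
`x_max = g` / `(lo+Kγ)/(lo+K)`) and transported to every `y ≤ ȳ` by monotonicity (`pb_glue_cap`, `pb_glue_cost`).  Certificates: Handelman products found
by kit (`g33/code/kitjob6`: scipy/HiGHS dual simplex for the support + exact rational repair), checked here by `linarith`.

HONEST STATUS.  Algebra only.  `SiblingStep`, `GluedDominatedMass`, `SDECConvClosed`, `FarTreeRow` OPEN; RATE class (log\*) / honest sentence of
`run/shared/lean/prim/quant/README.md` unchanged.  [this work].  Nothing here is cited as a published result.  The gluing rows served
[cite: KozmaNitzan2024, Conjecture 3 (p. 15)]; product measure [cite: Grimmett1999, §1.3 p. 10].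
-/

noncomputable section

open scoped BigOperators

namespace Summit.CriticalPhenomena.PercolationContinuityZ3.Theorems
namespace Quant
namespace LawDec

/-! ### Small algebra for the two-absorber route -/

/-- saturating the near absorber: `(ρ/(1−ρ))·(c(B−D)/D) = c` for `ρ = D/B`. [this work] -/
theorem pb_rate_sat {B D c : ℝ} (hB : 0 < B) (hD : 0 < D) (hBD : D < B) :
    (D / B) / (1 - D / B) * (c * (B - D) / D) = c := by
  have hB0 : B ≠ 0 := hB.ne'
  have hD0 : D ≠ 0 := hD.ne'
  have hBD0 : B - D ≠ 0 := by linarith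
  field_simp

/-- the split flows add up: `c·g(B−D)/D + c(D−Bg)/D = c(1−g)`. [this work] -/
theorem pb_split_sum {B D c g : ℝ} (hD : 0 < D) : c * g * (B - D) / D + c * (D - B * g) / D = c * (1 - g) := by
  rw [← add_div, div_eq_iff hD.ne']
  ring

/-- cost of the overflow at the ρ-rate of the top: `(ρ/(1−ρ))·(c·u/D) = c·u/(L−D)` for `ρ = D/L`. [this work] -/
theorem pb_rate_top {L D c u : ℝ} (hL : 0 < L) (hD : 0 < D) (hLD : D < L) :
    (D / L) / (1 - D / L) * (c * u / D) = c * u / (L - D) := by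
  have hL0 : L ≠ 0 := hL.ne'
  have hD0 : D ≠ 0 := hD.ne'
  have hLD0 : L - D ≠ 0 := by linarith
  field_simp


/-! ### From the `ȳ`-form certificates to the `y`-form bricks (monotonicity in the floor) -/

/-- monotone glue for the floor capacity of the overflow. [this work] -/
theorem pb_glue_cap {S G u ub Tt : ℝ} (hb : ub * S ≤ G * (Tt - ub)) (hu : u ≤ ub) (hS : 0 ≤ S) (hG : 0 ≤ G) : u * S ≤ G * (Tt - u) := by
  have h1 : u * S ≤ ub * S := mul_le_mul_of_nonneg_right hu hS
  have h2 : G * (Tt - ub) ≤ G * (Tt - u) := mul_le_mul_of_nonneg_left (by linarith) hG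
  linarith

/-- brick PB2GD on the whole range (case split over the three shape boxes). [this work] -/
theorem pb_PB2GD (lo K γ g D : ℝ) (hlo : 0 < lo) (hK1 : lo ≤ K) (hK4 : K ≤ 4 * lo)
    (hγ : lo ≤ K * γ) (hγ1 : γ ≤ 1) (hbig : 2 * lo ≤ (lo + K) * g) (hg1 : g ≤ 1) (hγ0 : 0 ≤ γ) (hg0 : 0 ≤ g) (hD : 0 ≤ D) (hDBg' : (lo + K) * g ≤ D) (hBD' : D ≤ lo + K) (hDmax' : D ≤ (K * γ - lo + (lo + K) * g)) (hxmG : (lo + K) * g ≤ lo + K * γ) (hTgG : (2 * lo + D) * g ≤ (lo + K * γ + (lo + K) * g)) :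
    (2 * lo + D) * g * (1 - γ) * (D - (lo + K) * g)
      ≤ γ * g * D * ((lo + K * γ + (lo + K) * g) - (2 * lo + D) * g) := by
  rcases le_total K (2 * lo) with hK2' | hK2
  · exact pbC_PB2GD lo K γ g D hlo hK1 hK2' hγ hγ1 hbig hg1 hD hDBg' hBD' hDmax' hγ0 hg0 hxmG hTgG
  · rcases le_total K (3 * lo) with hK3' | hK3
    · exact pbB_PB2GD lo K γ g D hlo hK2 hK3' hγ hγ1 hbig hg1 hD hDBg' hBD' hDmax' hγ0 hg0 hxmG hTgG
    · exact pbA_PB2GD lo K γ g D hlo hK3 hK4 hγ hγ1 hbig hg1 hD hDBg' hBD' hDmax' hγ0 hg0 hxmG hTgG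

/-- brick PB2XD on the whole range (case split over the three shape boxes). [this work] -/
theorem pb_PB2XD (lo K γ g D : ℝ) (hlo : 0 < lo) (hK1 : lo ≤ K) (hK4 : K ≤ 4 * lo)
    (hγ : lo ≤ K * γ) (hγ1 : γ ≤ 1) (hbig : 2 * lo ≤ (lo + K) * g) (hg1 : g ≤ 1) (hγ0 : 0 ≤ γ) (hg0 : 0 ≤ g) (hD : 0 ≤ D) (hDBg' : (lo + K) * g ≤ D) (hBD' : D ≤ lo + K) (hDmax' : D ≤ (K * γ - lo + (lo + K) * g)) (hxmX : lo + K * γ ≤ (lo + K) * g) (hTPX : (2 * lo + D) * (lo + K * γ) ≤ (lo + K) * (lo + K * γ + (lo + K) * g)) :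
    (2 * lo + D) * (lo + K * γ) * (1 - γ) * (D - (lo + K) * g)
      ≤ γ * g * D * ((lo + K) * (lo + K * γ + (lo + K) * g) - (2 * lo + D) * (lo + K * γ)) := by
  rcases le_total K (2 * lo) with hK2' | hK2
  · exact pbC_PB2XD lo K γ g D hlo hK1 hK2' hγ1 hbig hg1 hD hDBg' hBD' hDmax' hγ0 hg0 hxmX hTPX
  · rcases le_total K (3 * lo) with hK3' | hK3
    · exact pbB_PB2XD lo K γ g D hlo hK2 hK3' hγ1 hbig hg1 hD hDBg' hBD' hDmax' hγ0 hg0 hxmX hTPX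
    · exact pbA_PB2XD lo K γ g D hlo hK3 hK4 hγ hγ1 hbig hg1 hD hDBg' hBD' hDmax' hγ0 hg0 hxmX hTPX

/-- brick PB2 (floor capacity of the overflow) from the certificates at the floor bound `ȳ = (2lo+D)·x_max/T₀`. [this work] -/
theorem pb_PB2 (lo K γ g D y : ℝ) (hlo : 0 < lo) (hK1 : lo ≤ K) (hK4 : K ≤ 4 * lo)
    (hγ : lo ≤ K * γ) (hγ1 : γ ≤ 1) (hbig : 2 * lo ≤ (lo + K) * g) (hg1 : g ≤ 1) (hD : 0 ≤ D) (hDBg' : (lo + K) * g ≤ D) (hBD' : D ≤ lo + K)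
    (hDmax' : D ≤ (K * γ - lo + (lo + K) * g)) (_hy0 : 0 ≤ y) (_hy1 : y ≤ 1) (_hDyB' : y * (lo + K) ≤ D)
    (hyg' : y * (lo + K * γ + (lo + K) * g) ≤ (2 * lo + D) * g)
    (hyB' : y * (lo + K * γ + (lo + K) * g) * (lo + K) ≤ (2 * lo + D) * (lo + K * γ)) :
    y * (1 - γ) * (D - (lo + K) * g) ≤ γ * g * D * (1 - y) := by
  have hK : 0 < K := lt_of_lt_of_le hlo hK1
  have hγ0 : 0 ≤ γ := by
    by_contra hc; push Not at hc; have := mul_neg_of_pos_of_neg hK hc; linarith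
  have hB : 0 < lo + K := by linarith
  have hg0 : 0 ≤ g := by
    by_contra hc; push Not at hc; have := mul_neg_of_pos_of_neg hB hc; linarith
  have hT0 : 0 < lo + K * γ + (lo + K) * g := by have := mul_nonneg hK.le hγ0; have := mul_nonneg hB.le hg0; linarith
  have hS : 0 ≤ (1 - γ) * (D - (lo + K) * g) := mul_nonneg (by linarith) (by linarith)
  have hG : 0 ≤ γ * g * D := mul_nonneg (mul_nonneg hγ0 hg0) hD
  have hT : 2 * lo + D ≤ lo + K * γ + (lo + K) * g := by linarith
  rcases le_total ((lo + K) * g) (lo + K * γ) with hxm | hxm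
  · have hTg : (2 * lo + D) * g ≤ lo + K * γ + (lo + K) * g := by
      have := mul_le_mul hT hg1 hg0 hT0.le; linarith
    have hb := pb_PB2GD lo K γ g D hlo hK1 hK4 hγ hγ1 hbig hg1 hγ0 hg0 hD hDBg' hBD' hDmax' hxm hTg
    have hb' : (2 * lo + D) * g * ((1 - γ) * (D - (lo + K) * g)) ≤ γ * g * D * ((lo + K * γ + (lo + K) * g) - (2 * lo + D) * g) := by
      have e : (2 * lo + D) * g * ((1 - γ) * (D - (lo + K) * g)) = (2 * lo + D) * g * (1 - γ) * (D - (lo + K) * g) := by ring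
      rw [e]; exact hb
    have h := pb_glue_cap hb' hyg' hS hG
    -- `h : (y·T₀)·S ≤ G·(T₀ − y·T₀)`; divide by `T₀`
    have e1 : y * (lo + K * γ + (lo + K) * g) * ((1 - γ) * (D - (lo + K) * g)) = (lo + K * γ + (lo + K) * g) * (y * (1 - γ) * (D - (lo + K) * g)) := by
      ring
    have e2 : γ * g * D * ((lo + K * γ + (lo + K) * g) - y * (lo + K * γ + (lo + K) * g)) = (lo + K * γ + (lo + K) * g) * (γ * g * D * (1 - y)) := by
      ring
    rw [e1, e2] at h
    exact le_of_mul_le_mul_left h hT0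
  · have hP : lo + K * γ ≤ lo + K := by have := mul_le_mul_of_nonneg_left hγ1 hK.le; linarith
    have hP0 : 0 ≤ lo + K * γ := by have := mul_nonneg hK.le hγ0; linarith
    have hTP : (2 * lo + D) * (lo + K * γ) ≤ (lo + K) * (lo + K * γ + (lo + K) * g) := by
      have := mul_le_mul hT hP hP0 hT0.le; linarith
    have hb := pb_PB2XD lo K γ g D hlo hK1 hK4 hγ hγ1 hbig hg1 hγ0 hg0 hD hDBg' hBD' hDmax' hxm hTP
    have hb' : (2 * lo + D) * (lo + K * γ) * ((1 - γ) * (D - (lo + K) * g))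
        ≤ γ * g * D * ((lo + K) * (lo + K * γ + (lo + K) * g) - (2 * lo + D) * (lo + K * γ)) := by
      have e : (2 * lo + D) * (lo + K * γ) * ((1 - γ) * (D - (lo + K) * g)) = (2 * lo + D) * (lo + K * γ) * (1 - γ) * (D - (lo + K) * g) := by ring
      rw [e]; exact hb
    have hu : y * (lo + K * γ + (lo + K) * g) * (lo + K) ≤ (2 * lo + D) * (lo + K * γ) := hyB'
    have h := pb_glue_cap hb' hu hS hG
    have e1 : y * (lo + K * γ + (lo + K) * g) * (lo + K) * ((1 - γ) * (D - (lo + K) * g))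
        = ((lo + K * γ + (lo + K) * g) * (lo + K)) * (y * (1 - γ) * (D - (lo + K) * g)) := by ring
    have e2 : γ * g * D * ((lo + K) * (lo + K * γ + (lo + K) * g) - y * (lo + K * γ + (lo + K) * g) * (lo + K))
        = ((lo + K * γ + (lo + K) * g) * (lo + K)) * (γ * g * D * (1 - y)) := by ring
    rw [e1, e2] at h
    exact le_of_mul_le_mul_left h (mul_pos hT0 hB)


end LawDec
end Quant
end Summit.CriticalPhenomena.PercolationContinuityZ3.Theorems
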